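import Mathlib.Algebra.Homology.Embedding.StupidTrunc
import Mathlib.Algebra.Homology.Embedding.HomEquiv
import Mathlib.Algebra.Homology.Embedding.CochainComplex
import Mathlib.Algebra.Homology.HomologicalComplexAbelian
import HarnessLib

/-!
# The stupid filtration of a cochain complex and its short exact sequences

Mathlib has the **stupid truncation** `K.stupidTrunc e = (K.restriction e).extend e` of a complex
along an embedding `e` of complex shapes (`Mathlib/Algebra/Homology/Embedding/StupidTrunc.lean`:
the terms of `K` in the image of `e.f`, zero elsewhere), but the projection `K ⟶ K.stupidTrunc e`
for `e.IsTruncLE` is a TODO there. We construct it (`πStupidTrunc`, `πStupidTruncNatTrans`: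
Mathlib's `Embedding.liftExtend` of `𝟙 (K.restriction e)`, the lifting condition being vacuous) and
specialise to `ℤ`-indexed cochain complexes and `embeddingUpIntLE n : j ↦ n - j`, writing
`σ≤n K = stupidTruncLE K n` for `⋯ → Kⁿ⁻¹ → Kⁿ → 0 → ⋯` (Weibel, *An introduction to homological
algebra*, 1.2.7, "brutal truncation"; Deligne's "filtration bête", *Théorie de Hodge II*, §1.4):

* `stupidTruncLEXIso : (σ≤n K).X i ≅ K.X i` (`i ≤ n`), `isZero_stupidTruncLE_X` (`n < i`),
  `stupidTruncLE_d_eq`; `σ≤n K` is strictly `≤ n` and inherits every `K.IsStrictlyGE a` (both by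
  Mathlib instances), `isStrictlyLE_stupidTruncLE` (`≤ m` for `n ≤ m`), and `σ≤n₀ K = 0` when `K`
  is strictly `≥ n₁ > n₀` (`isZero_stupidTruncLE`);
* the projection `stupidTruncLEπ K n : K ⟶ σ≤n K` (identity in degrees `≤ n`, zero above):
  components, naturality in `K`, degreewise epi, iso iff `K` is strictly `≤ n`;
* the transition maps `stupidTruncLEMapOfLE K a b h : σ≤b K ⟶ σ≤a K` (`a ≤ b`) of the tower
  `K → ⋯ → σ≤(n+1) K → σ≤n K → ⋯` (the **stupid filtration**), compatible with the
  projections, transitive, natural in `K`;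
* the top term `singleToStupidTruncLE K n : Kⁿ[-n] ⟶ σ≤n K`, with
  `Kⁿ[-n] = (CochainComplex.singleFunctor C n).obj (K.X n)` (the spelling of Mathlib's `Ext` and
  of `Literature.Algebra.Homology.HyperExt`), natural in `K`;
* **the short exact sequences** `0 → Kⁿ¹[-n₁] → σ≤n₁ K → σ≤n₀ K → 0` (`n₀ + 1 = n₁`):
  `stupidFiltrationShortComplex`, `shortExact_stupidFiltrationShortComplex` (degreewise split),
  and the morphism of short complexes `stupidFiltrationShortComplexMap φ` induced by `φ : K ⟶ L`
  (the input of naturality statements for connecting maps such as `HyperExt.delta_naturality`).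

Use: the hyper-Ext / hypercohomology of a bounded complex `K = [K⁰ → ⋯ → Kʳ⁻¹]` is unscrewed
from the `Ext`'s of its terms by induction along this tower (`σ≤(r-1) K ≅ K`, `σ≤(-1) K = 0`) and
the long exact sequences of these short exact sequences (e.g. X. Hu, arXiv:2507.12458, proof of
Lemma 9.2 and the complexes `p(r)Ω•` of §11; Bloch–Esnault–Kerz, arXiv:1203.2776).
Not here: the inclusion `K.stupidTrunc e ⟶ K` for `e.IsTruncGE` and the `σ≥` side; the stupid
filtration as a filtered complex and its spectral sequence. Everything is proved. [folklore]
-/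

noncomputable section

namespace Literature.Algebra.Homology

open CategoryTheory Category Limits ZeroObject

universe v u

/-! ### The projection onto a stupid truncation, for a general `≤`-embedding -/

section General

variable {ι ι' : Type*} {c : ComplexShape ι} {c' : ComplexShape ι'}
  {C : Type u} [Category.{v} C] [HasZeroMorphisms C] [HasZeroObject C]
  (K L : HomologicalComplex C c') (φ : K ⟶ L) (e : c.Embedding c')

/-- The differential of the stupid truncation `K.stupidTrunc e` between two degrees of the image
of `e` is the differential of `K`, transported along the identifications `stupidTruncXIso`.
[folklore] -/
theorem stupidTrunc_d_eq [e.IsRelIff] {i j : ι} {i' j' : ι'} (hi : e.f i = i')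
    (hj : e.f j = j') :
    (K.stupidTrunc e).d i' j' =
      (K.stupidTruncXIso e hi).hom ≫ K.d i' j' ≫ (K.stupidTruncXIso e hj).inv := by
  dsimp only [HomologicalComplex.stupidTrunc, HomologicalComplex.stupidTruncXIso]
  rw [(K.restriction e).extend_d_eq e hi hj, K.restriction_d_eq e hi hj]
  simp [HomologicalComplex.restrictionXIso]

variable {K L} in
/-- The components of `stupidTruncMap φ e` (functoriality of the stupid truncation in `K`) in the
degrees of the image of `e` are the components of `φ`. [folklore] -/
theorem stupidTruncMap_f_eq [e.IsRelIff] {i : ι} {i' : ι'} (hi : e.f i = i') :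
    (HomologicalComplex.stupidTruncMap φ e).f i' =
      (K.stupidTruncXIso e hi).hom ≫ φ.f i' ≫ (L.stupidTruncXIso e hi).inv := by
  rw [← cancel_mono (L.stupidTruncXIso e hi).hom, assoc, assoc, Iso.inv_hom_id, comp_id,
    HomologicalComplex.stupidTruncMap_stupidTruncXIso_hom]

variable [e.IsTruncLE]

/-- The **projection `K ⟶ K.stupidTrunc e` onto a stupid truncation**, for an embedding `e` of
complex shapes whose image is stable under predecessors (`e.IsTruncLE`): the identity of `K.X i'`
in the degrees `i'` of the image of `e`, zero elsewhere (Mathlib's `Embedding.liftExtend` applied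
to `𝟙 (K.restriction e)`; the lifting condition is vacuous: no lower boundary). [folklore] -/
def πStupidTrunc : K ⟶ K.stupidTrunc e :=
  e.liftExtend (𝟙 (K.restriction e)) (fun _ hj _ _ => (hj.false_of_isTruncLE).elim)

/-- In a degree `i' = e.f i` of the image of `e`, the projection `πStupidTrunc K e` is the
(inverse of the) identification `(K.stupidTrunc e).X i' ≅ K.X i'`. [folklore] -/
theorem πStupidTrunc_f_eq {i : ι} {i' : ι'} (hi : e.f i = i') :
    (πStupidTrunc K e).f i' = (K.stupidTruncXIso e hi).inv := by
  dsimp only [πStupidTrunc, HomologicalComplex.stupidTrunc, HomologicalComplex.stupidTruncXIso]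
  rw [e.liftExtend_f _ _ hi]
  simp [HomologicalComplex.restrictionXIso]

/-- Outside the image of `e` the projection `πStupidTrunc K e` vanishes. [folklore] -/
theorem πStupidTrunc_f_eq_zero (i' : ι') (hi' : ∀ i, e.f i ≠ i') :
    (πStupidTrunc K e).f i' = 0 :=
  (K.isZero_stupidTrunc_X e i' hi').eq_of_tgt _ _

variable {K L} in
/-- Naturality of the projection `K ⟶ K.stupidTrunc e` in `K`. [folklore] -/
@[reassoc (attr := simp)]
theorem πStupidTrunc_naturality :
    πStupidTrunc K e ≫ HomologicalComplex.stupidTruncMap φ e = φ ≫ πStupidTrunc L e := by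
  ext i'
  by_cases hi' : ∃ i, e.f i = i'
  · obtain ⟨i, hi⟩ := hi'
    simp [πStupidTrunc_f_eq _ e hi, stupidTruncMap_f_eq φ e hi]
  · exact (L.isZero_stupidTrunc_X e i' (by simpa using hi')).eq_of_tgt _ _

variable (C) in
/-- The projections `K ⟶ K.stupidTrunc e` as a natural transformation
`𝟭 _ ⟶ e.stupidTruncFunctor C`. [folklore] -/
@[simps]
def πStupidTruncNatTrans : 𝟭 (HomologicalComplex C c') ⟶ e.stupidTruncFunctor C where
  app K := πStupidTrunc K e
  naturality _ _ φ := (πStupidTrunc_naturality φ e).symm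

/-- The projection `K ⟶ K.stupidTrunc e` is an epimorphism in every degree. [folklore] -/
instance epi_πStupidTrunc_f (i' : ι') : Epi ((πStupidTrunc K e).f i') := by
  by_cases hi' : ∃ i, e.f i = i'
  · obtain ⟨i, hi⟩ := hi'
    rw [πStupidTrunc_f_eq K e hi]
    infer_instance
  · exact (K.isZero_stupidTrunc_X e i' (by simpa using hi')).epi _

/-- If `K` is strictly supported on the image of `e`, the projection `K ⟶ K.stupidTrunc e` is an
isomorphism. [folklore] -/
instance isIso_πStupidTrunc [K.IsStrictlySupported e] : IsIso (πStupidTrunc K e) := by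
  suffices ∀ i' : ι', IsIso ((πStupidTrunc K e).f i') from
    HomologicalComplex.Hom.isIso_of_components _
  intro i'
  by_cases hi' : ∃ i, e.f i = i'
  · obtain ⟨i, hi⟩ := hi'
    rw [πStupidTrunc_f_eq K e hi]
    infer_instance
  · exact ⟨0, (K.isZero_X_of_isStrictlySupported e i' (by simpa using hi')).eq_of_src _ _,
      (K.isZero_stupidTrunc_X e i' (by simpa using hi')).eq_of_src _ _⟩

end General

/-! ### `ℤ`-indexed cochain complexes: the truncations `σ≤n K` -/

section CochainComplex

open ComplexShape

variable {C : Type u} [Category.{v} C]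

section HasZeroMorphisms

variable [HasZeroMorphisms C] [HasZeroObject C] (K L : CochainComplex C ℤ) (φ : K ⟶ L)

/-- The **stupid truncation `σ≤n K`** of a `ℤ`-indexed cochain complex:
`⋯ → Kⁿ⁻¹ → Kⁿ → 0 → 0 → ⋯` (the terms of `K` in degrees `≤ n`, zero above), i.e. Mathlib's
`K.stupidTrunc (embeddingUpIntLE n)`. [folklore] -/
abbrev stupidTruncLE (n : ℤ) : CochainComplex C ℤ := K.stupidTrunc (embeddingUpIntLE n)

variable {K L} in
/-- Functoriality `σ≤n K ⟶ σ≤n L` of the stupid truncation in the complex (Mathlib's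
`stupidTruncMap`). [folklore] -/
abbrev stupidTruncLEMap (n : ℤ) : stupidTruncLE K n ⟶ stupidTruncLE L n :=
  HomologicalComplex.stupidTruncMap φ (embeddingUpIntLE n)

/-- The identification `(σ≤n K).X i ≅ K.X i` in a degree `i ≤ n`. [folklore] -/
def stupidTruncLEXIso (n i : ℤ) (hi : i ≤ n) : (stupidTruncLE K n).X i ≅ K.X i :=
  K.stupidTruncXIso (embeddingUpIntLE n) (i := (n - i).toNat)
    (by simp only [embeddingUpIntLE_f]; omega)

/-- `(σ≤n K).X i = 0` in a degree `i > n`. [folklore] -/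
theorem isZero_stupidTruncLE_X (n i : ℤ) (hi : n < i) : IsZero ((stupidTruncLE K n).X i) :=
  K.isZero_stupidTrunc_X _ i ((notMem_range_embeddingUpIntLE_iff n i).2 hi)

/-- `σ≤n₀ K = 0` if `K` is strictly concentrated in degrees `≥ n₁ > n₀`. [folklore] -/
theorem isZero_stupidTruncLE (n₀ n₁ : ℤ) (h : n₀ < n₁) [K.IsStrictlyGE n₁] :
    IsZero (stupidTruncLE K n₀) := by
  rw [HomologicalComplex.isZero_stupidTrunc_iff]
  exact ⟨fun j => K.isZero_of_isStrictlyGE n₁ _ (by simp only [embeddingUpIntLE_f]; omega)⟩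

/-- `σ≤n K` is strictly `≤ m` for every `m ≥ n` (for `m = n` this is also an instance, from
Mathlib, as is `(σ≤n K).IsStrictlyGE a` whenever `K.IsStrictlyGE a`). [folklore] -/
theorem isStrictlyLE_stupidTruncLE (n m : ℤ) (h : n ≤ m) : (stupidTruncLE K n).IsStrictlyLE m :=
  CochainComplex.isStrictlyLE_of_le _ n m h

/-- The differential of `σ≤n K` between degrees `i, j ≤ n` is the differential of `K`. [folklore] -/
theorem stupidTruncLE_d_eq (n i j : ℤ) (hi : i ≤ n) (hj : j ≤ n) :
    (stupidTruncLE K n).d i j =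
      (stupidTruncLEXIso K n i hi).hom ≫ K.d i j ≫ (stupidTruncLEXIso K n j hj).inv :=
  stupidTrunc_d_eq K _ _ _

variable {K L} in
/-- The components of `σ≤n φ` in degrees `i ≤ n` are those of `φ`. [folklore] -/
theorem stupidTruncLEMap_f_eq (n i : ℤ) (hi : i ≤ n) :
    (stupidTruncLEMap φ n).f i =
      (stupidTruncLEXIso K n i hi).hom ≫ φ.f i ≫ (stupidTruncLEXIso L n i hi).inv :=
  stupidTruncMap_f_eq φ _ _

/-- The **projection `K ⟶ σ≤n K`**: the identity in degrees `≤ n`, zero above. [folklore] -/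
def stupidTruncLEπ (n : ℤ) : K ⟶ stupidTruncLE K n := πStupidTrunc K (embeddingUpIntLE n)

/-- In a degree `i ≤ n` the projection `K ⟶ σ≤n K` is the identification `K.X i ≅ (σ≤n K).X i`.
[folklore] -/
theorem stupidTruncLEπ_f_eq (n i : ℤ) (hi : i ≤ n) :
    (stupidTruncLEπ K n).f i = (stupidTruncLEXIso K n i hi).inv :=
  πStupidTrunc_f_eq K _ _

/-- In a degree `i > n` the projection `K ⟶ σ≤n K` is zero. [folklore] -/
theorem stupidTruncLEπ_f_eq_zero (n i : ℤ) (hi : n < i) : (stupidTruncLEπ K n).f i = 0 :=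
  (isZero_stupidTruncLE_X K n i hi).eq_of_tgt _ _

variable {K L} in
/-- Naturality of the projection `K ⟶ σ≤n K` in `K`. [folklore] -/
@[reassoc (attr := simp)]
theorem stupidTruncLEπ_naturality (n : ℤ) :
    stupidTruncLEπ K n ≫ stupidTruncLEMap φ n = φ ≫ stupidTruncLEπ L n :=
  πStupidTrunc_naturality φ _

/-- The projection `K ⟶ σ≤n K` is an epimorphism in every degree. [folklore] -/
instance epi_stupidTruncLEπ_f (n i : ℤ) : Epi ((stupidTruncLEπ K n).f i) := by
  dsimp only [stupidTruncLEπ]; infer_instance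

/-- The projection `K ⟶ σ≤n K` is an isomorphism when `K` is strictly `≤ n`. [folklore] -/
instance isIso_stupidTruncLEπ (n : ℤ) [K.IsStrictlyLE n] : IsIso (stupidTruncLEπ K n) := by
  dsimp only [stupidTruncLEπ]; infer_instance

/-- The projection `K ⟶ σ≤n K` is an isomorphism iff `K` is strictly `≤ n`. [folklore] -/
theorem isIso_stupidTruncLEπ_iff (n : ℤ) : IsIso (stupidTruncLEπ K n) ↔ K.IsStrictlyLE n :=
  ⟨fun _ => HomologicalComplex.isStrictlySupported_of_iso (asIso (stupidTruncLEπ K n)).symm _,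
    fun _ => inferInstance⟩

/-- The **transition map `σ≤b K ⟶ σ≤a K`** (`a ≤ b`) of the stupid filtration: the identity in
degrees `≤ a`, zero above. [folklore] -/
def stupidTruncLEMapOfLE (a b : ℤ) (h : a ≤ b) : stupidTruncLE K b ⟶ stupidTruncLE K a where
  f i :=
    if hi : i ≤ a then (stupidTruncLEXIso K b i (hi.trans h)).hom ≫ (stupidTruncLEXIso K a i hi).inv
    else 0
  comm' i j hij := by
    by_cases hj : j ≤ a
    · have hi : i ≤ a := by change i + 1 = j at hij; omega
      rw [dif_pos hi, dif_pos hj, stupidTruncLE_d_eq K b i j (hi.trans h) (hj.trans h),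
        stupidTruncLE_d_eq K a i j hi hj]
      simp
    · exact (isZero_stupidTruncLE_X K a j (not_le.1 hj)).eq_of_tgt _ _

/-- In a degree `i ≤ a` the transition map `σ≤b K ⟶ σ≤a K` is the identity of `K.X i`. [folklore] -/
theorem stupidTruncLEMapOfLE_f_eq (a b : ℤ) (h : a ≤ b) (i : ℤ) (hi : i ≤ a) :
    (stupidTruncLEMapOfLE K a b h).f i =
      (stupidTruncLEXIso K b i (hi.trans h)).hom ≫ (stupidTruncLEXIso K a i hi).inv :=
  dif_pos hi

/-- In a degree `i > a` the transition map `σ≤b K ⟶ σ≤a K` is zero. [folklore] -/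
theorem stupidTruncLEMapOfLE_f_eq_zero (a b : ℤ) (h : a ≤ b) (i : ℤ) (hi : a < i) :
    (stupidTruncLEMapOfLE K a b h).f i = 0 :=
  dif_neg (not_le.2 hi)

/-- The transition maps are compatible with the projections:
`(K ⟶ σ≤b K ⟶ σ≤a K) = (K ⟶ σ≤a K)`. [folklore] -/
@[reassoc (attr := simp)]
theorem stupidTruncLEπ_comp_stupidTruncLEMapOfLE (a b : ℤ) (h : a ≤ b) :
    stupidTruncLEπ K b ≫ stupidTruncLEMapOfLE K a b h = stupidTruncLEπ K a := by
  ext i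
  by_cases hi : i ≤ a
  · simp [stupidTruncLEMapOfLE_f_eq K a b h i hi, stupidTruncLEπ_f_eq K b i (hi.trans h),
      stupidTruncLEπ_f_eq K a i hi]
  · exact (isZero_stupidTruncLE_X K a i (not_le.1 hi)).eq_of_tgt _ _

/-- Transitivity `(σ≤c K ⟶ σ≤b K ⟶ σ≤a K) = (σ≤c K ⟶ σ≤a K)`. [folklore] -/
@[reassoc (attr := simp)]
theorem stupidTruncLEMapOfLE_comp (a b c : ℤ) (hab : a ≤ b) (hbc : b ≤ c) :
    stupidTruncLEMapOfLE K b c hbc ≫ stupidTruncLEMapOfLE K a b hab =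
      stupidTruncLEMapOfLE K a c (hab.trans hbc) := by
  ext i
  by_cases hi : i ≤ a
  · simp [stupidTruncLEMapOfLE_f_eq K a b hab i hi, stupidTruncLEMapOfLE_f_eq K b c hbc i
      (hi.trans hab), stupidTruncLEMapOfLE_f_eq K a c (hab.trans hbc) i hi]
  · exact (isZero_stupidTruncLE_X K a i (not_le.1 hi)).eq_of_tgt _ _

variable {K L} in
/-- Naturality of the transition maps `σ≤b K ⟶ σ≤a K` in `K`. [folklore] -/
@[reassoc (attr := simp)]
theorem stupidTruncLEMapOfLE_naturality (a b : ℤ) (h : a ≤ b) :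
    stupidTruncLEMapOfLE K a b h ≫ stupidTruncLEMap φ a =
      stupidTruncLEMap φ b ≫ stupidTruncLEMapOfLE L a b h := by
  ext i
  by_cases hi : i ≤ a
  · simp [stupidTruncLEMapOfLE_f_eq _ a b h i hi, stupidTruncLEMap_f_eq φ a i hi,
      stupidTruncLEMap_f_eq φ b i (hi.trans h)]
  · exact (isZero_stupidTruncLE_X L a i (not_le.1 hi)).eq_of_tgt _ _

end HasZeroMorphisms

section Preadditive

variable [Preadditive C] [HasZeroObject C] (K L : CochainComplex C ℤ) (φ : K ⟶ L)

/-- The **inclusion of the top term `Kⁿ[-n] ⟶ σ≤n K`** (`Kⁿ[-n]` = the single complex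
`(CochainComplex.singleFunctor C n).obj (K.X n)`): the identity of `Kⁿ` in degree `n`. [folklore] -/
def singleToStupidTruncLE (n : ℤ) :
    (CochainComplex.singleFunctor C n).obj (K.X n) ⟶ stupidTruncLE K n :=
  HomologicalComplex.mkHomFromSingle (stupidTruncLEXIso K n n le_rfl).inv
    (fun k hk => (isZero_stupidTruncLE_X K n k
      (by change n + 1 = k at hk; omega)).eq_of_tgt _ _)

/-- The degree-`n` component of `Kⁿ[-n] ⟶ σ≤n K` is the identification `Kⁿ ≅ (σ≤n K).X n`.
[folklore] -/
@[simp]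
theorem singleToStupidTruncLE_f_self (n : ℤ) :
    (singleToStupidTruncLE K n).f n =
      (HomologicalComplex.singleObjXSelf (up ℤ) n (K.X n)).hom ≫
        (stupidTruncLEXIso K n n le_rfl).inv :=
  HomologicalComplex.mkHomFromSingle_f _ _

-- Below, as in `Mathlib.Algebra.Homology.HomotopyCategory.HomComplexSingle`: `singleFunctor C n`
-- is `HomologicalComplex.single _ _ n` only up to unfolding, to be done in implicit arguments.
set_option backward.isDefEq.respectTransparency false in
/-- The degree-`n` component of `Kⁿ[-n] ⟶ σ≤n K` is an isomorphism. [folklore] -/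
instance isIso_singleToStupidTruncLE_f_self (n : ℤ) :
    IsIso ((singleToStupidTruncLE K n).f n) := by
  rw [singleToStupidTruncLE_f_self]
  infer_instance

set_option backward.isDefEq.respectTransparency false in
variable {K L} in
/-- Naturality of `Kⁿ[-n] ⟶ σ≤n K` in `K`. [folklore] -/
@[reassoc (attr := simp)]
theorem singleToStupidTruncLE_naturality (n : ℤ) :
    singleToStupidTruncLE K n ≫ stupidTruncLEMap φ n =
      (CochainComplex.singleFunctor C n).map (φ.f n) ≫ singleToStupidTruncLE L n := by
  apply HomologicalComplex.from_single_hom_ext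
  simp [CochainComplex.singleFunctor, CochainComplex.singleFunctors,
    HomologicalComplex.single_map_f_self, stupidTruncLEMap_f_eq φ n n le_rfl]

/-- The short complex `Kⁿ¹[-n₁] ⟶ σ≤n₁ K ⟶ σ≤n₀ K` of the stupid filtration (`n₀ + 1 = n₁`).
[folklore] -/
@[simps]
def stupidFiltrationShortComplex (n₀ n₁ : ℤ) (h : n₀ + 1 = n₁) :
    ShortComplex (CochainComplex C ℤ) where
  X₁ := (CochainComplex.singleFunctor C n₁).obj (K.X n₁)
  X₂ := stupidTruncLE K n₁
  X₃ := stupidTruncLE K n₀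
  f := singleToStupidTruncLE K n₁
  g := stupidTruncLEMapOfLE K n₀ n₁ (by omega)
  zero := by
    refine HomologicalComplex.hom_ext _ _ (fun i => ?_)
    by_cases hi : i ≤ n₀
    · exact (HomologicalComplex.isZero_single_obj_X (up ℤ) n₁ (K.X n₁) i
        (by omega)).eq_of_src _ _
    · simp [stupidTruncLEMapOfLE_f_eq_zero K n₀ n₁ (by omega) i (not_le.1 hi)]

variable {K L} in
/-- Functoriality of `Kⁿ¹[-n₁] ⟶ σ≤n₁ K ⟶ σ≤n₀ K` in `K`: the morphism of short complexes
induced by `φ : K ⟶ L` (three commuting squares). [folklore] -/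
@[simps]
def stupidFiltrationShortComplexMap (n₀ n₁ : ℤ) (h : n₀ + 1 = n₁) :
    stupidFiltrationShortComplex K n₀ n₁ h ⟶ stupidFiltrationShortComplex L n₀ n₁ h where
  τ₁ := (CochainComplex.singleFunctor C n₁).map (φ.f n₁)
  τ₂ := stupidTruncLEMap φ n₁
  τ₃ := stupidTruncLEMap φ n₀
  comm₁₂ := (singleToStupidTruncLE_naturality φ n₁).symm
  comm₂₃ := (stupidTruncLEMapOfLE_naturality φ n₀ n₁ (by omega)).symm

end Preadditive

section Abelian

variable [Abelian C] (K : CochainComplex C ℤ)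

/-- **The short exact sequences of the stupid filtration**: for `n₀ + 1 = n₁`,
`0 → Kⁿ¹[-n₁] → σ≤n₁ K → σ≤n₀ K → 0` is a short exact sequence of complexes (degreewise split:
`Kⁿ¹ = Kⁿ¹ → 0` in degree `n₁`, `0 → Kⁱ = Kⁱ` for `i < n₁`, `0` for `i > n₁`). [folklore] -/
theorem shortExact_stupidFiltrationShortComplex (n₀ n₁ : ℤ) (h : n₀ + 1 = n₁) :
    (stupidFiltrationShortComplex K n₀ n₁ h).ShortExact := by
  apply HomologicalComplex.shortExact_of_degreewise_shortExact
  intro i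
  by_cases hi : n₁ = i
  · subst hi
    refine (ShortComplex.Splitting.ofIsIsoOfIsZero _ ?_ ?_).shortExact
    · change IsIso ((singleToStupidTruncLE K n₁).f n₁)
      infer_instance
    · exact isZero_stupidTruncLE_X K n₀ n₁ (by omega)
  · refine (ShortComplex.Splitting.ofIsZeroOfIsIso _ ?_ ?_).shortExact
    · exact HomologicalComplex.isZero_single_obj_X (up ℤ) n₁ (K.X n₁) i (Ne.symm hi)
    · change IsIso ((stupidTruncLEMapOfLE K n₀ n₁ (by omega)).f i)
      by_cases hi' : i ≤ n₀
      · rw [stupidTruncLEMapOfLE_f_eq K n₀ n₁ (by omega) i hi']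
        infer_instance
      · exact ⟨0, (isZero_stupidTruncLE_X K n₁ i (by omega)).eq_of_src _ _,
          (isZero_stupidTruncLE_X K n₀ i (by omega)).eq_of_src _ _⟩

end Abelian

end CochainComplex

end Literature.Algebra.Homology
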